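/-
Copyright (c) 2026 the pub-hodgecm-mathlib formalisation cell (harness21).  Prover seat hodgecm-mathlib-K2E3-p12 (g5), Track B «K2-LIT» ∕ h413
(`stmt-HodgeConjecture-24833`), line `K2_E3_EllipticInputs`, unit U12-d, §L (G⁺-b)∕(K5b): THE TWISTED `K`-AVERAGES `X ↦ ∫_K χ̃(det k)·ω((k⁻¹Xk)₁₀) dκ` —
MEASURABILITY, BOUNDS, LINEARITY IN THE WEIGHT, AND THE UNIFORM CONSTANCY EXPONENT OF THE SLICE FUNCTIONS `G_k`.  2026-09-04.
-/
import Summits.HodgeConjecture.HodgeConjecture.Theorems.K2E3GL2TwistedLinePairingBochner        -- ★ p857405 (K2E5-p10 g4): (K1′) `integral_twistedLinePairing` (frame, entry map)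
import Summits.HodgeConjecture.HodgeConjecture.Theorems.K2E3LocalFieldQuadraticCharSignWeight     -- ★ p857419 (K2E5-p17 g3): `norm_extend_le_one`
import Literature.NumberTheory.Automorphic.TateGaussSums                                          -- ★ `TateDirect.extend_*`, `measurable_extend`
import Literature.NumberTheory.Automorphic.TateLocalZetaShells                                    -- ★ `exists_primePowBall_subset_of_mem_nhds_zero`
import Literature.Topology.LocallyConstantCompactSupportUniform                                    -- ★ `exists_nhds_one_forall_mul_eq_of_hasCompactSupport`
import HarnessLib

/-!
# K2_E3 road (h413), §L — (G⁺-b)∕(K5b): the twisted `K`-averages and the uniform constancy exponent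

Cell `pub/hodgecm-mathlib` (D-0151), Track B, seat K2E3-p12 (g5), §L line lead (road «U-iso-T»; the orphaned K-side of K2E5-p10 (g4), re-dealt 05:22Z).
`--supports stmt-HodgeConjecture-24833 --as helper`; THEOREMS ONLY (no definition ∕ instance ∕ notation ∕ named fact ∕ `sorry`); never imports `Cruxes/…/Lines`.
Count-neutral plumbing for (K5) = the payer of the hosted leaf (LBGL-2b-Tw) `sig_K2E3GL2TwistedRegularNilpotentFourier` (U12 ED. 14 :797).

Currency (frozen on the bus 05:25Z): `χ̃ = Function.extend Units.val (χ ·) 0` for a quadratic quasi-character `χ`; a WEIGHT is any measurable bounded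
`ω : F → ℂ`; the TWISTED `K`-AVERAGE of `ω` is the function `X ↦ ∫_K χ̃(det k)·ω((k⁻¹Xk)₁₀) dκ(k)` on `𝔤𝔩₂(F)` (`K = GL₂(𝒪)`, `κ` finite); the SLICE
FUNCTION of `f ∈ C_c^∞(𝔤𝔩₂(F))` at `k` is `G_k(s) = ∫_{F³} f(k [[r₀,r₁],[s,r₂]] k⁻¹) dr`.

* §1 `extend_mul_of_ne_zero_right` — `χ̃(t·d) = χ̃(t)·χ̃(d)` for `d ≠ 0` (all `t`).
* §2 `measurable_twistedKIntegrand`, **`aestronglyMeasurable_twistedKAverage`**, **`norm_twistedKAverage_le`**, **`integrable_mul_twistedKAverage`**,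
  **`twistedKAverage_add`**, `twistedKAverage_const_mul` — the `K`-averages of bounded measurable weights are bounded measurable functions of `X`, linear in `ω`.
* §3 **`exists_forall_sliceFn_eq_of_mem_primePowBall`** — ONE constancy exponent for all `k ∈ K`: `∃ N : ℤ, ∀ k ∈ GL₂(𝒪), ∀ s ∈ 𝔭^N, G_k(s) = G_k(0)`
  (uniform local constancy of `f` ★ + the tube lemma over the compact `K`: `k·(sE₂₁)·k⁻¹ → 0` uniformly).

HONEST LABEL: HC_CM is proved only modulo the 7 printed citations (2 remaining named inputs: hLiu418 = stmt-HodgeConjecture-24832, h413 = stmt-HodgeConjecture-24833)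
until rung 0 closes; count-neutral plumbing.

References: [HarishChandra1999AdmissibleDistributions] Harish-Chandra (DeBacker–Sally) (1999), Lemma 5.2, §7; [BernsteinZelevinsky1976] Bernstein–Zelevinsky (1976), §1.1
(uniform local constancy); [LabesseLanglands1979] Labesse–Langlands (1979), §2.
-/

set_option autoImplicit false
set_option linter.dupNamespace false   -- `Summit.HodgeConjecture.HodgeConjecture.…` (D-0017 nested layout; lakefile exemption for Summits)

noncomputable section

open MeasureTheory Measure Filter Topology TopologicalSpace Set
open scoped MatrixGroups NNReal ENNReal
open Literature.NumberTheory.Rogawski1990 Literature.NumberTheory.Automorphic Literature.NumberTheory.Automorphic.LocalFieldHaar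
open Literature.NumberTheory.GaloisRepresentations Literature.NumberTheory.GaloisRepresentations.IsNonarchimedeanLocalField
open Summit.HodgeConjecture.HodgeConjecture.Cruxes.H413.K2E3LocalFieldQuadraticCharSignWeight (norm_extend_le_one)

namespace Summit.HodgeConjecture.HodgeConjecture.Cruxes.H413.K2E3GL2TwistedKAverage

variable {F : Type*} [Field F] [ValuativeRel F] [TopologicalSpace F] [IsNonarchimedeanLocalField F]

/-! ## §1  `χ̃` is multiplicative against units -/

omit [ValuativeRel F] [IsNonarchimedeanLocalField F] in
/-- `χ̃(t·d) = χ̃(t)·χ̃(d)` for every `t` and every `d ≠ 0` (`χ̃(0) = 0` on both sides when `t = 0`). [folklore] -/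
theorem extend_mul_of_ne_zero_right (χ : QuasiChar F) (t : F) {d : F} (hd : d ≠ 0) :
    Function.extend ((↑) : Fˣ → F) (fun u => ((χ u : ℂˣ) : ℂ)) 0 (t * d) =
      Function.extend ((↑) : Fˣ → F) (fun u => ((χ u : ℂˣ) : ℂ)) 0 t * Function.extend ((↑) : Fˣ → F) (fun u => ((χ u : ℂˣ) : ℂ)) 0 d := by
  by_cases ht : t = 0
  · rw [ht, zero_mul, TateDirect.extend_apply_zero, zero_mul]
  · exact TateDirect.extend_mul χ ht hd

/-! ## §2  The twisted `K`-averages of bounded measurable weights -/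

section KAverage

variable [MeasurableSpace F] [BorelSpace F] [MeasurableSpace (GL (Fin 2) F)] [BorelSpace (GL (Fin 2) F)]
  [MeasurableSpace (Matrix (Fin 2) (Fin 2) F)] [BorelSpace (Matrix (Fin 2) (Fin 2) F)]
  (χ : QuasiChar F) (κ : Measure ↥(glInt 2 F)) [IsFiniteMeasure κ]

/-- The integrand `(k, X) ↦ χ̃(det k)·ω((k⁻¹Xk)₁₀)` of the twisted `K`-average is jointly measurable (`ω` measurable). [folklore] -/
theorem measurable_twistedKIntegrand {ω : F → ℂ} (hω : Measurable ω) :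
    Measurable fun p : ↥(glInt 2 F) × Matrix (Fin 2) (Fin 2) F =>
      Function.extend ((↑) : Fˣ → F) (fun u => ((χ u : ℂˣ) : ℂ)) 0 (((p.1 : GL (Fin 2) F) : Matrix (Fin 2) (Fin 2) F)).det *
        ω ((((((p.1 : GL (Fin 2) F))⁻¹ : GL (Fin 2) F) : Matrix (Fin 2) (Fin 2) F) * p.2 * ((p.1 : GL (Fin 2) F) : Matrix (Fin 2) (Fin 2) F)) 1 0) := by
  haveI : T2Space F := (isLocalField F).toT2Space
  haveI : SecondCountableTopology F := secondCountableTopology_localField F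
  haveI : SecondCountableTopology (Matrix (Fin 2) (Fin 2) F) := inferInstanceAs (SecondCountableTopology (Fin 2 → Fin 2 → F))
  haveI : BorelSpace ↥(glInt 2 F) := Subtype.borelSpace _
  have hdet : Continuous fun p : ↥(glInt 2 F) × Matrix (Fin 2) (Fin 2) F => (((p.1 : GL (Fin 2) F) : Matrix (Fin 2) (Fin 2) F)).det :=
    (Continuous.matrix_det Units.continuous_val).comp (continuous_subtype_val.comp continuous_fst)
  have hentry : Continuous fun p : ↥(glInt 2 F) × Matrix (Fin 2) (Fin 2) F =>
      ((((((p.1 : GL (Fin 2) F))⁻¹ : GL (Fin 2) F) : Matrix (Fin 2) (Fin 2) F) * p.2 * ((p.1 : GL (Fin 2) F) : Matrix (Fin 2) (Fin 2) F)) 1 0) := by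
    refine (continuous_id.matrix_elem 1 0).comp ?_
    exact ((Units.continuous_coe_inv.comp (continuous_subtype_val.comp continuous_fst)).mul continuous_snd).mul
      (Units.continuous_val.comp (continuous_subtype_val.comp continuous_fst))
  exact ((TateDirect.measurable_extend χ).comp hdet.measurable).mul (hω.comp hentry.measurable)

/-- **The twisted `K`-average `X ↦ ∫_K χ̃(det k)·ω((k⁻¹Xk)₁₀) dκ` is a.e.-strongly measurable** on `𝔤𝔩₂(F)` (`ω` measurable; Fubini measurability).
[cite: HarishChandra1999AdmissibleDistributions, §7] -/
theorem aestronglyMeasurable_twistedKAverage {ω : F → ℂ} (hω : Measurable ω) (μ𝔤 : Measure (Matrix (Fin 2) (Fin 2) F)) :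
    AEStronglyMeasurable (fun X : Matrix (Fin 2) (Fin 2) F => ∫ k : ↥(glInt 2 F),
      Function.extend ((↑) : Fˣ → F) (fun u => ((χ u : ℂˣ) : ℂ)) 0 (((k : GL (Fin 2) F) : Matrix (Fin 2) (Fin 2) F)).det *
        ω ((((((k : GL (Fin 2) F))⁻¹ : GL (Fin 2) F) : Matrix (Fin 2) (Fin 2) F) * X * ((k : GL (Fin 2) F) : Matrix (Fin 2) (Fin 2) F)) 1 0) ∂κ) μ𝔤 :=
  ((measurable_twistedKIntegrand χ hω).stronglyMeasurable.integral_prod_left' (μ := κ)).aestronglyMeasurable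

omit [IsNonarchimedeanLocalField F] [MeasurableSpace F] [BorelSpace F] [BorelSpace (GL (Fin 2) F)] [MeasurableSpace (Matrix (Fin 2) (Fin 2) F)]
  [BorelSpace (Matrix (Fin 2) (Fin 2) F)] in
/-- **Pointwise bound**: `‖∫_K χ̃(det k)·ω((k⁻¹Xk)₁₀) dκ‖ ≤ M·κ(K)` when `‖ω‖ ≤ M` (`‖χ̃‖ ≤ 1` for quadratic `χ`). [folklore] -/
theorem norm_twistedKAverage_le (hχ2 : ∀ u, χ u * χ u = 1) {ω : F → ℂ} {M : ℝ} (hωb : ∀ s, ‖ω s‖ ≤ M) (X : Matrix (Fin 2) (Fin 2) F) :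
    ‖∫ k : ↥(glInt 2 F), Function.extend ((↑) : Fˣ → F) (fun u => ((χ u : ℂˣ) : ℂ)) 0 (((k : GL (Fin 2) F) : Matrix (Fin 2) (Fin 2) F)).det *
        ω ((((((k : GL (Fin 2) F))⁻¹ : GL (Fin 2) F) : Matrix (Fin 2) (Fin 2) F) * X * ((k : GL (Fin 2) F) : Matrix (Fin 2) (Fin 2) F)) 1 0) ∂κ‖ ≤
      M * κ.real Set.univ := by
  refine norm_integral_le_of_norm_le_const (Eventually.of_forall fun k => ?_)
  rw [norm_mul]
  have hM : 0 ≤ M := (norm_nonneg _).trans (hωb 0)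
  calc _ ≤ 1 * M := mul_le_mul (norm_extend_le_one χ hχ2 _) (hωb _) (norm_nonneg _) zero_le_one
    _ = M := one_mul M

/-- **`f · (twisted K-average)` is integrable** on `𝔤𝔩₂(F)` for `f ∈ C_c^∞` and a bounded measurable weight. [folklore] -/
theorem integrable_mul_twistedKAverage (hχ2 : ∀ u, χ u * χ u = 1) {ω : F → ℂ} (hω : Measurable ω) {M : ℝ} (hωb : ∀ s, ‖ω s‖ ≤ M)
    (μ𝔤 : Measure (Matrix (Fin 2) (Fin 2) F)) [IsFiniteMeasureOnCompacts μ𝔤] {f : Matrix (Fin 2) (Fin 2) F → ℂ} (hf : IsLocSmooth f) :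
    Integrable (fun X : Matrix (Fin 2) (Fin 2) F => f X * ∫ k : ↥(glInt 2 F),
      Function.extend ((↑) : Fˣ → F) (fun u => ((χ u : ℂˣ) : ℂ)) 0 (((k : GL (Fin 2) F) : Matrix (Fin 2) (Fin 2) F)).det *
        ω ((((((k : GL (Fin 2) F))⁻¹ : GL (Fin 2) F) : Matrix (Fin 2) (Fin 2) F) * X * ((k : GL (Fin 2) F) : Matrix (Fin 2) (Fin 2) F)) 1 0) ∂κ) μ𝔤 := by
  have hfi : Integrable f μ𝔤 := hf.continuous.integrable_of_hasCompactSupport hf.2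
  exact hfi.mul_bdd (aestronglyMeasurable_twistedKAverage χ κ hω μ𝔤) (Eventually.of_forall fun X => norm_twistedKAverage_le χ κ hχ2 hωb X)

omit [MeasurableSpace (Matrix (Fin 2) (Fin 2) F)] [BorelSpace (Matrix (Fin 2) (Fin 2) F)] in
/-- The integrand `k ↦ χ̃(det k)·ω((k⁻¹Xk)₁₀)` of the twisted `K`-average is integrable on `K` (bounded measurable, `κ` finite). [folklore] -/
theorem integrable_twistedKIntegrand (hχ2 : ∀ u, χ u * χ u = 1) {ω : F → ℂ} (hω : Measurable ω) {M : ℝ} (hb : ∀ s, ‖ω s‖ ≤ M)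
    (X : Matrix (Fin 2) (Fin 2) F) :
    Integrable (fun k : ↥(glInt 2 F) =>
      Function.extend ((↑) : Fˣ → F) (fun u => ((χ u : ℂˣ) : ℂ)) 0 (((k : GL (Fin 2) F) : Matrix (Fin 2) (Fin 2) F)).det *
        ω ((((((k : GL (Fin 2) F))⁻¹ : GL (Fin 2) F) : Matrix (Fin 2) (Fin 2) F) * X * ((k : GL (Fin 2) F) : Matrix (Fin 2) (Fin 2) F)) 1 0)) κ := by
  haveI : T2Space F := (isLocalField F).toT2Space
  haveI : BorelSpace ↥(glInt 2 F) := Subtype.borelSpace _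
  have hdet : Measurable fun k : ↥(glInt 2 F) => (((k : GL (Fin 2) F) : Matrix (Fin 2) (Fin 2) F)).det :=
    ((Continuous.matrix_det Units.continuous_val).comp continuous_subtype_val).measurable
  have hent : Measurable fun k : ↥(glInt 2 F) =>
      ((((((k : GL (Fin 2) F))⁻¹ : GL (Fin 2) F) : Matrix (Fin 2) (Fin 2) F) * X * ((k : GL (Fin 2) F) : Matrix (Fin 2) (Fin 2) F)) 1 0) :=
    ((continuous_id.matrix_elem 1 0).comp (((Units.continuous_coe_inv.comp continuous_subtype_val).mul continuous_const).mul
      (Units.continuous_val.comp continuous_subtype_val))).measurable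
  have hm : Measurable fun k : ↥(glInt 2 F) =>
      Function.extend ((↑) : Fˣ → F) (fun u => ((χ u : ℂˣ) : ℂ)) 0 (((k : GL (Fin 2) F) : Matrix (Fin 2) (Fin 2) F)).det *
        ω ((((((k : GL (Fin 2) F))⁻¹ : GL (Fin 2) F) : Matrix (Fin 2) (Fin 2) F) * X * ((k : GL (Fin 2) F) : Matrix (Fin 2) (Fin 2) F)) 1 0) :=
    ((TateDirect.measurable_extend χ).comp hdet).mul (hω.comp hent)
  refine Integrable.of_bound hm.aestronglyMeasurable M (Eventually.of_forall fun k => ?_)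
  rw [norm_mul]
  have hM : 0 ≤ M := (norm_nonneg _).trans (hb 0)
  calc _ ≤ 1 * M := mul_le_mul (norm_extend_le_one χ hχ2 _) (hb _) (norm_nonneg _) zero_le_one
    _ = M := one_mul M

omit [MeasurableSpace (Matrix (Fin 2) (Fin 2) F)] [BorelSpace (Matrix (Fin 2) (Fin 2) F)] in
/-- **Additivity of the twisted `K`-average in the weight** (bounded measurable weights; `κ` finite). [folklore] -/
theorem twistedKAverage_add (hχ2 : ∀ u, χ u * χ u = 1) {ω₁ ω₂ : F → ℂ} (hω₁ : Measurable ω₁) (hω₂ : Measurable ω₂) {M₁ M₂ : ℝ}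
    (hb₁ : ∀ s, ‖ω₁ s‖ ≤ M₁) (hb₂ : ∀ s, ‖ω₂ s‖ ≤ M₂) (X : Matrix (Fin 2) (Fin 2) F) :
    ∫ k : ↥(glInt 2 F), Function.extend ((↑) : Fˣ → F) (fun u => ((χ u : ℂˣ) : ℂ)) 0 (((k : GL (Fin 2) F) : Matrix (Fin 2) (Fin 2) F)).det *
        (ω₁ + ω₂) ((((((k : GL (Fin 2) F))⁻¹ : GL (Fin 2) F) : Matrix (Fin 2) (Fin 2) F) * X * ((k : GL (Fin 2) F) : Matrix (Fin 2) (Fin 2) F)) 1 0) ∂κ =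
      (∫ k : ↥(glInt 2 F), Function.extend ((↑) : Fˣ → F) (fun u => ((χ u : ℂˣ) : ℂ)) 0 (((k : GL (Fin 2) F) : Matrix (Fin 2) (Fin 2) F)).det *
        ω₁ ((((((k : GL (Fin 2) F))⁻¹ : GL (Fin 2) F) : Matrix (Fin 2) (Fin 2) F) * X * ((k : GL (Fin 2) F) : Matrix (Fin 2) (Fin 2) F)) 1 0) ∂κ) +
      ∫ k : ↥(glInt 2 F), Function.extend ((↑) : Fˣ → F) (fun u => ((χ u : ℂˣ) : ℂ)) 0 (((k : GL (Fin 2) F) : Matrix (Fin 2) (Fin 2) F)).det *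
        ω₂ ((((((k : GL (Fin 2) F))⁻¹ : GL (Fin 2) F) : Matrix (Fin 2) (Fin 2) F) * X * ((k : GL (Fin 2) F) : Matrix (Fin 2) (Fin 2) F)) 1 0) ∂κ := by
  refine (integral_congr_ae (Eventually.of_forall fun k => ?_)).trans
    (integral_add (integrable_twistedKIntegrand χ κ hχ2 hω₁ hb₁ X) (integrable_twistedKIntegrand χ κ hχ2 hω₂ hb₂ X))
  simp only [Pi.add_apply]
  ring

omit [IsNonarchimedeanLocalField F] [MeasurableSpace F] [BorelSpace F] [BorelSpace (GL (Fin 2) F)] [MeasurableSpace (Matrix (Fin 2) (Fin 2) F)]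
  [BorelSpace (Matrix (Fin 2) (Fin 2) F)] [IsFiniteMeasure κ] in
/-- **Homogeneity of the twisted `K`-average in the weight.** [folklore] -/
theorem twistedKAverage_const_mul (ω : F → ℂ) (a : ℂ) (X : Matrix (Fin 2) (Fin 2) F) :
    ∫ k : ↥(glInt 2 F), Function.extend ((↑) : Fˣ → F) (fun u => ((χ u : ℂˣ) : ℂ)) 0 (((k : GL (Fin 2) F) : Matrix (Fin 2) (Fin 2) F)).det *
        (a * ω ((((((k : GL (Fin 2) F))⁻¹ : GL (Fin 2) F) : Matrix (Fin 2) (Fin 2) F) * X * ((k : GL (Fin 2) F) : Matrix (Fin 2) (Fin 2) F)) 1 0)) ∂κ =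
      a * ∫ k : ↥(glInt 2 F), Function.extend ((↑) : Fˣ → F) (fun u => ((χ u : ℂˣ) : ℂ)) 0 (((k : GL (Fin 2) F) : Matrix (Fin 2) (Fin 2) F)).det *
        ω ((((((k : GL (Fin 2) F))⁻¹ : GL (Fin 2) F) : Matrix (Fin 2) (Fin 2) F) * X * ((k : GL (Fin 2) F) : Matrix (Fin 2) (Fin 2) F)) 1 0) ∂κ := by
  rw [← integral_const_mul]
  exact integral_congr_ae (Eventually.of_forall fun k => by simp only [mul_left_comm _ a])

end KAverage

/-! ## §3  One constancy exponent for all slice functions `G_k`, `k ∈ K` -/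

section Slice

variable [MeasurableSpace F] (dx : Measure F)

omit [ValuativeRel F] [TopologicalSpace F] [IsNonarchimedeanLocalField F] [MeasurableSpace F] in
/-- `k [[r₀,r₁],[s,r₂]] k⁻¹ = k [[r₀,r₁],[0,r₂]] k⁻¹ + k (sE₂₁) k⁻¹`. [folklore] -/
theorem conj_slice_eq_add (k : GL (Fin 2) F) (r : Fin 3 → F) (s : F) :
    (k : Matrix (Fin 2) (Fin 2) F) * !![r 0, r 1; s, r 2] * ((k⁻¹ : GL (Fin 2) F) : Matrix (Fin 2) (Fin 2) F) =
      (k : Matrix (Fin 2) (Fin 2) F) * !![r 0, r 1; 0, r 2] * ((k⁻¹ : GL (Fin 2) F) : Matrix (Fin 2) (Fin 2) F) +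
        (k : Matrix (Fin 2) (Fin 2) F) * !![0, 0; s, 0] * ((k⁻¹ : GL (Fin 2) F) : Matrix (Fin 2) (Fin 2) F) := by
  have h : (!![r 0, r 1; s, r 2] : Matrix (Fin 2) (Fin 2) F) = !![r 0, r 1; 0, r 2] + !![0, 0; s, 0] := by
    ext i j; fin_cases i <;> fin_cases j <;> simp
  rw [h, Matrix.mul_add, Matrix.add_mul]

/-- **ONE CONSTANCY EXPONENT FOR ALL `k ∈ K`**: for `f ∈ C_c^∞(𝔤𝔩₂(F))` there is `N : ℤ` with `G_k(s) = G_k(0)` for every `k ∈ GL₂(𝒪)` and every `s ∈ 𝔭^N`,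
`G_k(s) = ∫_{F³} f(k [[r₀,r₁],[s,r₂]] k⁻¹) dr` — `f` is uniformly locally constant (★ Bernstein–Zelevinsky §1.1) and `k·(sE₂₁)·k⁻¹ → 0` as `s → 0` UNIFORMLY on the
compact `K` (tube lemma). [cite: BernsteinZelevinsky1976, §1.1] [cite: HarishChandra1999AdmissibleDistributions, Lemma 5.2] -/
theorem exists_forall_sliceFn_eq_of_mem_primePowBall {f : Matrix (Fin 2) (Fin 2) F → ℂ} (hf : IsLocSmooth f) :
    ∃ N : ℤ, ∀ k : ↥(glInt 2 F), ∀ s ∈ primePowBall F N,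
      ∫ r : Fin 3 → F, f (((k : GL (Fin 2) F) : Matrix (Fin 2) (Fin 2) F) * !![r 0, r 1; s, r 2] *
          ((((k : GL (Fin 2) F))⁻¹ : GL (Fin 2) F) : Matrix (Fin 2) (Fin 2) F)) ∂(Measure.pi fun _ : Fin 3 => dx) =
      ∫ r : Fin 3 → F, f (((k : GL (Fin 2) F) : Matrix (Fin 2) (Fin 2) F) * !![r 0, r 1; 0, r 2] *
          ((((k : GL (Fin 2) F))⁻¹ : GL (Fin 2) F) : Matrix (Fin 2) (Fin 2) F)) ∂(Measure.pi fun _ : Fin 3 => dx) := by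
  haveI : T2Space F := (isLocalField F).toT2Space
  haveI : IsTopologicalRing F := inferInstance
  haveI : CompactSpace ↥(glInt 2 F) := isCompact_iff_compactSpace.1 (isCompact_glInt 2 F)
  -- uniform local constancy of `f` on the additive group `𝔤𝔩₂(F)`
  obtain ⟨V, hV, hVf⟩ : ∃ V ∈ 𝓝 (0 : Matrix (Fin 2) (Fin 2) F), ∀ X : Matrix (Fin 2) (Fin 2) F, ∀ v ∈ V, f (X + v) = f X :=
    Literature.Topology.exists_nhds_one_forall_mul_eq_of_hasCompactSupport (G := Multiplicative (Matrix (Fin 2) (Fin 2) F))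
      (f := fun g : Multiplicative (Matrix (Fin 2) (Fin 2) F) => f (Multiplicative.toAdd g)) hf.1 hf.2
  -- the map `(k, s) ↦ k (sE₂₁) k⁻¹` is continuous and vanishes at `s = 0`
  let Φ : ↥(glInt 2 F) × F → Matrix (Fin 2) (Fin 2) F := fun p =>
    ((p.1 : GL (Fin 2) F) : Matrix (Fin 2) (Fin 2) F) * !![0, 0; p.2, 0] * ((((p.1 : GL (Fin 2) F))⁻¹ : GL (Fin 2) F) : Matrix (Fin 2) (Fin 2) F)
  have hΦc : Continuous Φ := by
    have h1 : Continuous fun p : ↥(glInt 2 F) × F => ((p.1 : GL (Fin 2) F) : Matrix (Fin 2) (Fin 2) F) :=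
      Units.continuous_val.comp (continuous_subtype_val.comp continuous_fst)
    have h2 : Continuous fun p : ↥(glInt 2 F) × F => (!![0, 0; p.2, 0] : Matrix (Fin 2) (Fin 2) F) := by
      refine continuous_matrix fun i j => ?_
      fin_cases i <;> fin_cases j <;> simp [continuous_const, continuous_snd]
    have h3 : Continuous fun p : ↥(glInt 2 F) × F => ((((p.1 : GL (Fin 2) F))⁻¹ : GL (Fin 2) F) : Matrix (Fin 2) (Fin 2) F) :=
      Units.continuous_coe_inv.comp (continuous_subtype_val.comp continuous_fst)
    exact (h1.mul h2).mul h3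
  have hΦ0 : ∀ k : ↥(glInt 2 F), Φ (k, 0) = 0 := fun k => by
    simp only [Φ]
    have : (!![0, 0; (0 : F), 0] : Matrix (Fin 2) (Fin 2) F) = 0 := by ext i j; fin_cases i <;> fin_cases j <;> simp
    rw [this, Matrix.mul_zero, Matrix.zero_mul]
  -- tube lemma: an open `U ∋ 0` in `F` with `Φ(K × U) ⊆ V`
  obtain ⟨V', hV'V, hV'o, hV'0⟩ := mem_nhds_iff.1 hV
  have hpre : IsOpen (Φ ⁻¹' V') := hV'o.preimage hΦc
  have hsub : (Set.univ : Set ↥(glInt 2 F)) ×ˢ ({0} : Set F) ⊆ Φ ⁻¹' V' := by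
    rintro ⟨k, s⟩ ⟨-, hs⟩
    rw [Set.mem_singleton_iff] at hs
    subst hs
    show Φ (k, 0) ∈ V'
    rw [hΦ0]; exact hV'0
  obtain ⟨u, w, -, hwo, hKu, h0w, huw⟩ := generalized_tube_lemma isCompact_univ isCompact_singleton hpre hsub
  have hw : w ∈ 𝓝 (0 : F) := hwo.mem_nhds (h0w (Set.mem_singleton 0))
  obtain ⟨n, hn⟩ := exists_primePowBall_subset_of_mem_nhds_zero hw
  refine ⟨(n : ℤ), fun k s hs => integral_congr_ae (Eventually.of_forall fun r => ?_)⟩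
  have hks : Φ (k, s) ∈ V := hV'V (huw (Set.mk_mem_prod (hKu (Set.mem_univ k)) (hn hs)))
  simp only
  rw [conj_slice_eq_add]
  exact hVf _ _ hks

end Slice

end Summit.HodgeConjecture.HodgeConjecture.Cruxes.H413.K2E3GL2TwistedKAverage

end
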